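import Summits.Schanuel.Schanuel.Theses.DiophantineDichotomy
import Literature.NumberTheory.Transcendental.ZilberFieldCCP

/-!
# Route `DiophantineDichotomy`, support item `KhovanskiiLocalInverse` (stmt-Schanuel-6121)

**Quantitative inverse function theorem at a non-degenerate Khovanskii point.**  For a
Khovanskii system `g₁, …, gₙ ∈ ℚ[z₁, …, zₙ, y₁, …, yₙ]` and a point `θ = (s, eˢ) ∈ ℂ²ⁿ` at which
the exponential Jacobian `det (∂gᵢ/∂zⱼ + yⱼ ∂gᵢ/∂yⱼ)(θ)` is non-zero, there are `c, r > 0` with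
`‖γ − θ‖ ≤ c · ε` whenever `‖γ − θ‖ < r`, `|gᵢ(γ)| ≤ ε` and `|e^{γ_{zⱼ}} − γ_{yⱼ}| ≤ ε`
(sup norm on `ℂ²ⁿ = (Fin n ⊕ Fin n → ℂ)`).

Proof (folklore; the "implicit function theorem at a non-degenerate solution" used silently in
Kirby 2010 §3 and Nesterenko–Philippon LNM 1752 Ch. 4): the map
`Φ(z, y) = (g(z, y), e^z − y) : ℂ²ⁿ → ℂ²ⁿ` is strictly differentiable at `θ`
(`Literature.NumberTheory.Transcendental.hasStrictFDerivAt_mvPolynomial_eval` for the polynomial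
block, `Complex.exp` for the other), and its derivative `Φ'` is injective: `Φ' v = 0` forces
`v_y = diag(eˢ) v_z` and then `M v_z = 0` for the exponential Jacobian matrix `M` of the
statement (block elimination / Schur complement), so `v = 0` as `det M ≠ 0`.  Hence `Φ'` is a
continuous linear equivalence of the finite-dimensional space `ℂ²ⁿ`, and Mathlib's inverse
function theorem (`HasStrictFDerivAt.approximates_deriv_on_open_nhds`,
`ApproximatesLinearOn.antilipschitz`) makes `Φ` anti-Lipschitz with some constant `K` on an open
neighbourhood `U ∋ θ`; with `Φ θ = 0` (the point solves the system) this reads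
`‖γ − θ‖ ≤ K ‖Φ γ‖ ≤ K ε` on a ball `B(θ, r) ⊆ U`, and `c = K + 1` works (the `+ 1` only keeps
`c > 0` in the degenerate case `n = 0`).

## References

* J. Kirby, *Exponential algebraicity in exponential fields*, Bull. LMS 42 (2010), §3.
* Yu. V. Nesterenko, P. Philippon (eds.), *Introduction to Algebraic Independence Theory*,
  LNM 1752 (2001), Ch. 4 §4.
-/

noncomputable section

-- `Summit.Schanuel.Schanuel.…` is the mandated summit/sub-problem namespace (single-conjunct
-- summit), hence:
set_option linter.dupNamespace false

open scoped BigOperators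

namespace Summit.Schanuel.Schanuel.Theorems

open MvPolynomial Literature.NumberTheory.Transcendental

/-- **Item stmt-Schanuel-6121 (`DiophantineDichotomy.KhovanskiiLocalInverse`), proved**: at a
non-degenerate zero `θ = (s, eˢ)` of a Khovanskii system `g` over `ℚ` there are `c, r > 0` such
that every `γ ∈ ℂ²ⁿ` with `‖γ − θ‖ < r`, `|gᵢ(γ)| ≤ ε` (all `i`) and `|e^{γ_{zⱼ}} − γ_{yⱼ}| ≤ ε`
(all `j`), `ε ≥ 0`, satisfies `‖γ − θ‖ ≤ c ε` — the quantitative (anti-Lipschitz) inverse function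
theorem for `Φ(z, y) = (g(z, y), e^z − y)`, whose Jacobian at `θ` reduces by block elimination to
the exponential Jacobian `det (∂_{zⱼ} gᵢ + yⱼ ∂_{yⱼ} gᵢ)(θ) ≠ 0`. [folklore] -/
theorem khovanskiiLocalInverse_proof :
    Summit.Schanuel.Schanuel.Theses.DiophantineDichotomy.KhovanskiiLocalInverse := by
  unfold Summit.Schanuel.Schanuel.Theses.DiophantineDichotomy.KhovanskiiLocalInverse
  intro n s g hzero hdet
  classical
  set θ : Fin n ⊕ Fin n → ℂ := Sum.elim s (Complex.exp ∘ s) with hθ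
  -- the system with coefficients mapped to `ℂ`
  set G : Fin n → MvPolynomial (Fin n ⊕ Fin n) ℂ := fun i => map (algebraMap ℚ ℂ) (g i) with hG
  have haeval : ∀ (γ : Fin n ⊕ Fin n → ℂ) (p : MvPolynomial (Fin n ⊕ Fin n) ℚ),
      aeval γ p = eval γ (map (algebraMap ℚ ℂ) p) := fun γ p => by
    rw [aeval_def, eval₂_eq_eval_map]
  -- the map `Φ(z, y) = (g(z, y), e^z - y)` and its derivative at `θ`
  set Φ : (Fin n ⊕ Fin n → ℂ) → (Fin n ⊕ Fin n → ℂ) := fun γ k =>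
    Sum.elim (fun i => eval γ (G i)) (fun j => Complex.exp (γ (Sum.inl j)) - γ (Sum.inr j)) k
    with hΦ
  set φ' : Fin n ⊕ Fin n → ((Fin n ⊕ Fin n → ℂ) →L[ℂ] ℂ) := fun k =>
    Sum.elim
      (fun i => ∑ k' : Fin n ⊕ Fin n, eval θ (pderiv k' (G i)) •
        ContinuousLinearMap.proj (R := ℂ) (φ := fun _ : Fin n ⊕ Fin n => ℂ) k')
      (fun j => Complex.exp (θ (Sum.inl j)) •
          ContinuousLinearMap.proj (R := ℂ) (φ := fun _ : Fin n ⊕ Fin n => ℂ) (Sum.inl j) -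
        ContinuousLinearMap.proj (R := ℂ) (φ := fun _ : Fin n ⊕ Fin n => ℂ) (Sum.inr j)) k
    with hφ'
  set Φ' : (Fin n ⊕ Fin n → ℂ) →L[ℂ] (Fin n ⊕ Fin n → ℂ) := ContinuousLinearMap.pi φ' with hΦ'
  have hderiv : HasStrictFDerivAt Φ Φ' θ := by
    rw [hΦ', hasStrictFDerivAt_pi']
    intro k
    rw [ContinuousLinearMap.proj_pi]
    rcases k with i | j
    · simpa [hΦ, hφ'] using hasStrictFDerivAt_mvPolynomial_eval (G i) θ
    · simpa [hΦ, hφ'] using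
        ((hasStrictFDerivAt_apply (𝕜 := ℂ) (Sum.inl j) θ).cexp).fun_sub
          (hasStrictFDerivAt_apply (𝕜 := ℂ) (Sum.inr j) θ)
  -- the derivative is injective: block elimination reduces its kernel to that of `M`
  set M : Matrix (Fin n) (Fin n) ℂ := Matrix.of fun i j => aeval θ
      (pderiv (Sum.inl j) (g i) + X (Sum.inr j) * pderiv (Sum.inr j) (g i)) with hM
  have hinj : Function.Injective Φ' := by
    rw [injective_iff_map_eq_zero]
    intro v hv
    have hk : ∀ k, φ' k v = 0 := fun k => by
      have := congrFun hv k
      simpa [hΦ'] using this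
    have hvr : ∀ j, v (Sum.inr j) = Complex.exp (s j) * v (Sum.inl j) := fun j => by
      have h := hk (Sum.inr j)
      simp only [hφ', Sum.elim_inr, _root_.sub_apply, _root_.smul_apply,
        ContinuousLinearMap.proj_apply, smul_eq_mul, hθ, Sum.elim_inl] at h
      exact (sub_eq_zero.1 h).symm
    have hMu : M.mulVec (fun j => v (Sum.inl j)) = 0 := by
      funext i
      have h := hk (Sum.inl i)
      simp only [hφ', Sum.elim_inl, _root_.sum_apply, _root_.smul_apply,
        ContinuousLinearMap.proj_apply, smul_eq_mul] at h
      rw [Fintype.sum_sum_type] at h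
      simp only [hvr] at h
      simp only [hM, Matrix.mulVec, dotProduct, Matrix.of_apply, Pi.zero_apply, map_add,
        map_mul, aeval_X]
      rw [← h, ← Finset.sum_add_distrib]
      refine Finset.sum_congr rfl fun j _ => ?_
      simp only [haeval, pderiv_map, hG, hθ, Sum.elim_inr, Function.comp_apply]
      ring
    have hu : (fun j => v (Sum.inl j)) = 0 := Matrix.eq_zero_of_mulVec_eq_zero hdet hMu
    funext k
    rcases k with j | j
    · exact congrFun hu j
    · rw [Pi.zero_apply, hvr j, show v (Sum.inl j) = 0 from congrFun hu j, mul_zero]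
  -- hence a continuous linear equivalence, and the inverse function theorem applies
  set Φe : (Fin n ⊕ Fin n → ℂ) ≃L[ℂ] (Fin n ⊕ Fin n → ℂ) :=
    (LinearEquiv.ofInjectiveEndo Φ'.toLinearMap hinj).toContinuousLinearEquiv with hΦe
  have hcoe : (Φe : (Fin n ⊕ Fin n → ℂ) →L[ℂ] (Fin n ⊕ Fin n → ℂ)) = Φ' := by
    ext v k
    rfl
  have hderiv' : HasStrictFDerivAt Φ (Φe : (Fin n ⊕ Fin n → ℂ) →L[ℂ] (Fin n ⊕ Fin n → ℂ)) θ := by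
    rw [hcoe]; exact hderiv
  obtain ⟨U, hθU, hUo, hU⟩ := hderiv'.approximates_deriv_on_open_nhds
  have hanti := hU.antilipschitz (Φe.subsingleton_or_nnnorm_symm_pos.imp id fun h =>
    NNReal.half_lt_self <| ne_of_gt <| inv_pos.2 h)
  set K : NNReal := (‖(Φe.symm : (Fin n ⊕ Fin n → ℂ) →L[ℂ] (Fin n ⊕ Fin n → ℂ))‖₊⁻¹ -
    ‖(Φe.symm : (Fin n ⊕ Fin n → ℂ) →L[ℂ] (Fin n ⊕ Fin n → ℂ))‖₊⁻¹ / 2)⁻¹ with hK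
  obtain ⟨r, hr, hball⟩ := Metric.isOpen_iff.1 hUo θ hθU
  refine ⟨K + 1, r, by positivity, hr, ?_⟩
  intro γ ε hε hγ hg hexp
  have hγU : γ ∈ U := hball (by rwa [Metric.mem_ball, dist_eq_norm])
  have hΦθ : Φ θ = 0 := by
    funext k
    rcases k with i | j
    · simp only [hΦ, Sum.elim_inl, Pi.zero_apply, hG, ← haeval]
      exact hzero i
    · simp [hΦ, hθ]
  have hΦγ : ‖Φ γ‖ ≤ ε := by
    rw [pi_norm_le_iff_of_nonneg hε]
    intro k
    rcases k with i | j
    · simpa [hΦ, hG, ← haeval] using hg i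
    · simpa [hΦ] using hexp j
  have hdist := hanti.le_mul_dist ⟨γ, hγU⟩ ⟨θ, hθU⟩
  rw [Subtype.dist_eq, dist_eq_norm, Set.restrict_apply, Set.restrict_apply, dist_eq_norm,
    hΦθ, sub_zero] at hdist
  calc ‖γ - θ‖ ≤ K * ‖Φ γ‖ := hdist
    _ ≤ K * ε := by gcongr
    _ ≤ (K + 1) * ε := mul_le_mul_of_nonneg_right (by simp) hε

end Summit.Schanuel.Schanuel.Theorems
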